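import Summits.ValiantsHypothesis.ValiantsHypothesis.Theorems.DefinabilityGapK2cVPSPACE0Rung
import Literature.Barriers.ValiantsHypothesis.CT23ProjCircuitInputNormalisation

/-!
# DefinabilityGap — K2c rung 4, read in Chatterjee–Tengse's class `VPSPACE_b(ℂ)` (Def. 2.22)

Route `DefinabilityGap`, crux K2c `KIAnnihilatorDefinableOnCollapse` (`stmt-ValiantsHypothesis-23546`). The integer
constant-free annihilator family of rung 4 (`DefinabilityGapK2cVPSPACE0Rung.k2c_vpspace0b_rung`, `IsVPSPACE0bFamily`),
read over `ℂ`, is a family in `VPSPACE_b` over the field `ℂ` in the paper's OFFICIAL typed sense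
`IsVPSPACEbFamily ℂ` (Def. 2.22: obtained from a `VPSPACE⁰` family by fixing some variables to field constants —
here none, `u = 0`), nonzero and annihilating the planted map `G_m = kiPer m` for `m ≥ m₁`. So the ladder under
K2c reads, in the source's own classes: `A ∈ VPSPACE_b(ℂ)` unconditionally; K2c asks `A' ∈ VNP_ℂ` under
`VP = VNP`. Consequence-side rung; NOT a lower bound; `VP ≠ VNP` is NOT proved.

## References

* [ChatterjeeTengse2023] P. Chatterjee, A. Tengse, *Lower Bounds from Succinct Hitting Sets*, arXiv:2309.07612v2,
  Def. 2.20, Def. 2.22 and §2.2 (`VPSPACE⁰`, `VPSPACE`, `VPSPACE_b`), Thm. 3.1.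
-/

noncomputable section

open MvPolynomial
open Literature.Computability.AlgebraicComplexity
open Literature.Barriers.ValiantsHypothesis
open Summit.ValiantsHypothesis.ValiantsHypothesis.Theorems.DefinabilityGapAffineRung (qOf kiPer)

namespace Summit.ValiantsHypothesis.ValiantsHypothesis.Theorems.DefinabilityGapK2cVPSPACEbRung

/-- **A `VPSPACE⁰` integer family read over a field is in `VPSPACE` over that field** (Def. 2.22 with no
constants fixed, `u = 0`). [cite: ChatterjeeTengse2023, Def. 2.20 and Def. 2.22 (v1: Def. 28–29)] -/
theorem isVPSPACEFamily_map_of_isVPSPACE0Family (F : Type) [Field F] {σ : ℕ → Type} [∀ N, Fintype (σ N)]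
    [∀ N, DecidableEq (σ N)] {A : ∀ N, MvPolynomial (σ N) ℤ} (hA : IsVPSPACE0Family A) :
    IsVPSPACEFamily F (fun N => map (Int.castRingHom F) (A N)) := by
  obtain ⟨hcard, t, Cq, ht, hC, hsize⟩ := hA
  have hinj : ∀ N, Function.Injective
      (Sum.map (Sum.inl : σ N → σ N ⊕ Fin 0) (id : Fin (t N) → Fin (t N))) := fun N =>
    Sum.map_injective.2 ⟨Sum.inl_injective, Function.injective_id⟩
  refine ⟨fun _ => 0, fun N => rename Sum.inl (A N), fun N j => j.elim0,
    ⟨hcard.mono fun N => le_of_eq (by rw [Fintype.card_sum, Fintype.card_fin, Nat.add_zero]), t, fun N => (Cq N).renameCircuit (Sum.map Sum.inl id), ht,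
      fun N => ⟨ProjCircuit.isFanInTwo_renameCircuit (hC N).1 _,
        ProjCircuit.hasSignConstants_renameCircuit (hC N).2.1 _, ?_⟩,
      hsize.mono fun N => by rw [ProjCircuit.size_renameCircuit]⟩, fun N => ?_⟩
  · rw [ProjCircuit.Computes, ProjCircuit.eval_renameCircuit _ (hinj N), show (Cq N).eval = _ from (hC N).2.2,
      rename_rename, rename_rename]
    rfl
  · rw [map_rename, aeval_rename, Sum.elim_comp_inl, aeval_X_left]
    rfl

/-- **K2c rung 4 in the class `VPSPACE_b(ℂ)`** (Def. 2.22): the planted Kabanets–Impagliazzo permanent map has,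
unconditionally, a family of annihilators in `VPSPACE_b` over `ℂ` (`IsVPSPACEbFamily ℂ`), nonzero for `m ≥ m₁`.
[cite: ChatterjeeTengse2023, Def. 2.22, §2.2 and Thm. 3.1; KabanetsImpagliazzo2003, Thm. 7.7] -/
theorem k2c_vpspaceb_rung :
    ∃ P : ∀ m : ℕ, MvPolynomial (Fin 3 → Fin (qOf m)) ℂ,
      IsVPSPACEbFamily ℂ (σ := fun m => Fin 3 → Fin (qOf m)) P ∧
        ∃ m₁, ∀ m, m₁ ≤ m → P m ≠ 0 ∧ bind₁ (kiPer m) (P m) = 0 := by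
  obtain ⟨A, ⟨h0, hdeg⟩, -, m₁, hann⟩ := DefinabilityGapK2cVPSPACE0Rung.k2c_vpspace0b_rung
  refine ⟨fun m => map (Int.castRingHom ℂ) (A m),
    ⟨isVPSPACEFamily_map_of_isVPSPACE0Family ℂ h0,
      hdeg.mono fun m => Finset.sup_mono (support_map_subset _ _)⟩,
    m₁, fun m hm => ⟨fun h => (hann m hm).1 ?_, (hann m hm).2⟩⟩
  exact map_injective _ (Int.castRingHom ℂ).injective_int (by rw [_root_.map_zero]; exact h)

end Summit.ValiantsHypothesis.ValiantsHypothesis.Theorems.DefinabilityGapK2cVPSPACEbRung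

end
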